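import Summits.NavierStokesRegularity.NavierStokesRegularity.Theorems.TypeICertificateLadderTargetFlowwiseDepletionCoeffSlab
import Summits.NavierStokesRegularity.NavierStokesRegularity.Theorems.TypeICertificateLadderRungReynoldsOneTaoCover
import Literature.Analysis.FluidPDE.TaoClassQuotientBalance
import Literature.Analysis.FluidPDE.AxisymQuotientEquationsOmega
import Literature.Analysis.FluidPDE.SerrinEnstrophyGronwall
import Literature.Analysis.FluidPDE.TaoSpeedContinuation
import HarnessLib

/-!
# Route `ExtremiserTransience`, LINE g4-α «per-flow-tangent» (ns-idea-5 g4): continuity in time of enstrophy and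
# palinstrophy along the flow; measurability of the LOCKED time set

`--supports stmt-NavierStokesRegularity-26568` (`TangentExtremalExtraction`; third file of the Lean plan for stub S1
`stub_lockedTimes_logDensity` of skeleton v3c — the bookkeeping half: the set of locked times is measurable).

For a classical solution on `[0,T) × ℝ³` issued from rapidly decaying Leray–Hopf data (Tao's class on every closed
slab, `RungReynoldsOne.stub_taoCover`):
* `continuousOn_enstrophy` — `t ↦ Z(t) = ‖curl u(t)‖₂²` is continuous on `[0,T)` (`IsSmoothSpaceTimeOn.l2_balance` for
  the vorticity family on each slab);
* `continuousOn_palinstrophy` — `t ↦ P(t) = ∫|∇curl u(t)|²_F` is continuous on `[0,T)` (`IsSmoothSpaceTimeOn.enstrophy_balance`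
  for the vorticity family, whose Sobolev bounds come from `hasBoundedSobolevNormsOn_curl`);
* `measurableSet_lockedTimes` — for any `a c : ℝ` the set `{t ∈ [a,T) : Z(t) ≤ c·(ν(T−t))·P(t)}` (the times at which the
  efficiency scale `λ = √(Z/P)` is parabolically LOCKED) is measurable.
HONEST FRAMING: nothing about Navier–Stokes regularity or blow-up is proved. [folklore]
References: P. G. Lemarié-Rieusset (2016), §11.6 (enstrophy balance). [folklore]
-/

noncomputable section

open Set Filter Topology MeasureTheory
open scoped RealInnerProductSpace ENNReal NNReal Laplacian ContDiff
open Literature.Analysis.FluidPDE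

namespace Summit.NavierStokesRegularity.NavierStokesRegularity.Theorems.DepletionLadder.PerFlow

set_option linter.dupNamespace false
set_option linter.style.longLine false

open Summit.NavierStokesRegularity.NavierStokesRegularity.Theorems.RungReynoldsOne
open Summit.NavierStokesRegularity.NavierStokesRegularity.Theorems.RungReynoldsOne.WeightedSlice

/-- **Slab continuity of enstrophy and palinstrophy** in Tao's class on a closed slab `[0,T]`. [folklore] -/
theorem continuousOn_enstrophy_palinstrophy_slab {ν T : ℝ} (hT : 0 < T)
    {u : ℝ → EuclideanSpace ℝ (Fin 3) → EuclideanSpace ℝ (Fin 3)}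
    {p : ℝ → EuclideanSpace ℝ (Fin 3) → ℝ} (hsol : IsClassicalNSSolutionOn (Icc 0 T) ν 0 u p)
    (hu : HasBoundedSobolevNormsOn (Icc 0 T) u)
    (hut : HasBoundedSobolevNormsOn (Icc 0 T) (timeDerivWithin (Icc 0 T) u)) :
    ContinuousOn (fun t => ∫ x, ‖curl (u t) x‖ ^ 2) (Icc 0 T) ∧
      ContinuousOn (fun t => ∫ x, frobeniusNormSq (fderiv ℝ (curl (u t)) x)) (Icc 0 T) := by
  have hU : UniqueDiffOn ℝ (Icc 0 T) := uniqueDiffOn_Icc hT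
  have hcl := Icc_subset_closure_interior_Icc' (T := T) hT
  set W : ℝ → EuclideanSpace ℝ (Fin 3) → EuclideanSpace ℝ (Fin 3) :=
    timeDerivWithin (Icc 0 T) u with hW
  have hWsm : IsSmoothSpaceTimeOn (Icc 0 T) W := hsol.smooth_velocity.timeDerivWithin hU
  have hwsm : IsSmoothSpaceTimeOn (Icc 0 T) (vorticity u) :=
    hsol.smooth_velocity.isSmoothSpaceTimeOn_vorticity hU
  -- Sobolev bounds of the vorticity family and of its time derivative
  have hω : HasBoundedSobolevNormsOn (Icc 0 T) (vorticity u) :=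
    HasBoundedSobolevNormsOn.congr (hasBoundedSobolevNormsOn_curl hu (fun t ht => hsol.contDiff_velocity ht))
      (fun t _ => rfl)
  have hωt : HasBoundedSobolevNormsOn (Icc 0 T) (timeDerivWithin (Icc 0 T) (vorticity u)) :=
    HasBoundedSobolevNormsOn.congr (hasBoundedSobolevNormsOn_curl hut (fun t ht => hWsm.contDiff_slice ht))
      (fun t ht => hsol.smooth_velocity.timeDerivWithin_vorticity_eq hU hcl ht)
  obtain ⟨C₀, hC₀⟩ := hω 0
  obtain ⟨D₀, hD₀⟩ := hωt 0
  obtain ⟨C₁, hC₁⟩ := hω 1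
  obtain ⟨D₁, hD₁⟩ := hωt 1
  have e0 : ∀ (f : EuclideanSpace ℝ (Fin 3) → EuclideanSpace ℝ (Fin 3)),
      ∫⁻ x, ‖f x‖ₑ ^ 2 = ∫⁻ x, ‖iteratedFDeriv ℝ 0 f x‖ₑ ^ 2 :=
    fun f => lintegral_congr fun x => by rw [← ofReal_norm, ← ofReal_norm, norm_iteratedFDeriv_zero]
  have hl2 := hwsm.l2_balance hT (C₀ := C₀) (C₁ := D₀) (fun t ht => by rw [e0]; exact hC₀ t ht)
    (fun t ht => by rw [e0]; exact hD₀ t ht)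
  have hen := hwsm.enstrophy_balance hT hC₁ hD₁
  exact ⟨hl2.2.1, hen.2.1⟩

/-- From slab continuity to continuity on `[0,T)`. [folklore] -/
theorem continuousOn_Ico_of_slabs {T : ℝ} {f : ℝ → ℝ}
    (h : ∀ T' ∈ Ioo 0 T, ContinuousOn f (Icc 0 T')) : ContinuousOn f (Ico 0 T) := by
  intro τ hτ
  set T' : ℝ := (τ + T) / 2 with hT'
  have hτT' : τ < T' := by rw [hT']; linarith [hτ.2]
  have hT'T : T' < T := by rw [hT']; linarith [hτ.2]
  have hT'0 : 0 < T' := lt_of_le_of_lt hτ.1 hτT'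
  have hc : ContinuousWithinAt f (Icc 0 T') τ := h T' ⟨hT'0, hT'T⟩ τ ⟨hτ.1, hτT'.le⟩
  refine hc.mono_of_mem_nhdsWithin ?_
  refine mem_nhdsWithin.2 ⟨Iio T', isOpen_Iio, hτT', fun s hs => ⟨hs.2.1, le_of_lt hs.1⟩⟩

/-- **Continuity of enstrophy and palinstrophy on `[0,T)`** for a classical solution issued from rapidly decaying
Leray–Hopf data. [folklore] -/
theorem continuousOn_enstrophy_palinstrophy {ν T : ℝ} (hν : 0 < ν) (hT : 0 < T)
    {u : ℝ → EuclideanSpace ℝ (Fin 3) → EuclideanSpace ℝ (Fin 3)} {p : ℝ → EuclideanSpace ℝ (Fin 3) → ℝ}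
    (hsol : IsClassicalNSSolutionOn (Ico 0 T) ν 0 u p) (hLH : IsLerayHopfOn T ν 0 (u 0) u)
    (hdec : HasRapidSpatialDecay (u 0)) :
    ContinuousOn (fun t => ∫ x, ‖curl (u t) x‖ ^ 2) (Ico 0 T) ∧
      ContinuousOn (fun t => ∫ x, frobeniusNormSq (fderiv ℝ (curl (u t)) x)) (Ico 0 T) := by
  have key : ∀ T' ∈ Ioo 0 T,
      ContinuousOn (fun t => ∫ x, ‖curl (u t) x‖ ^ 2) (Icc 0 T') ∧
        ContinuousOn (fun t => ∫ x, frobeniusNormSq (fderiv ℝ (curl (u t)) x)) (Icc 0 T') := by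
    intro T' hT'
    obtain ⟨q, hsolq, hBq, hBtq, -⟩ := RungReynoldsOne.stub_taoCover hν hT hsol hLH hdec hT'
    exact continuousOn_enstrophy_palinstrophy_slab hT'.1 hsolq hBq hBtq
  exact ⟨continuousOn_Ico_of_slabs fun T' hT' => (key T' hT').1,
    continuousOn_Ico_of_slabs fun T' hT' => (key T' hT').2⟩

/-- **Measurability of the locked time set** `{t ∈ [a,T) : Z(t) ≤ c·(ν(T−t))·P(t)}`. [folklore] -/
theorem measurableSet_lockedTimes {ν T : ℝ} (hν : 0 < ν) (hT : 0 < T)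
    {u : ℝ → EuclideanSpace ℝ (Fin 3) → EuclideanSpace ℝ (Fin 3)} {p : ℝ → EuclideanSpace ℝ (Fin 3) → ℝ}
    (hsol : IsClassicalNSSolutionOn (Ico 0 T) ν 0 u p) (hLH : IsLerayHopfOn T ν 0 (u 0) u)
    (hdec : HasRapidSpatialDecay (u 0)) (a c : ℝ) (ha : 0 ≤ a) :
    MeasurableSet {t : ℝ | t ∈ Ico a T ∧
      (∫ x, ‖curl (u t) x‖ ^ 2) ≤ c * (ν * (T - t)) * ∫ x, frobeniusNormSq (fderiv ℝ (curl (u t)) x)} := by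
  classical
  obtain ⟨hZ, hP⟩ := continuousOn_enstrophy_palinstrophy hν hT hsol hLH hdec
  set f : ℝ → ℝ := fun t => (∫ x, ‖curl (u t) x‖ ^ 2) -
    c * (ν * (T - t)) * ∫ x, frobeniusNormSq (fderiv ℝ (curl (u t)) x) with hf
  have hfc : ContinuousOn f (Ico 0 T) :=
    hZ.sub ((continuousOn_const.mul (continuousOn_const.mul (continuousOn_const.sub continuousOn_id))).mul hP)
  have hmeas : Measurable ((Ico 0 T).piecewise f 0) :=
    hfc.measurable_piecewise continuousOn_const measurableSet_Ico
  have hset : {t : ℝ | t ∈ Ico a T ∧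
      (∫ x, ‖curl (u t) x‖ ^ 2) ≤ c * (ν * (T - t)) * ∫ x, frobeniusNormSq (fderiv ℝ (curl (u t)) x)} =
      Ico a T ∩ {t | (Ico 0 T).piecewise f 0 t ≤ 0} := by
    ext t
    simp only [mem_setOf_eq, mem_inter_iff]
    constructor
    · rintro ⟨ht, hle⟩
      refine ⟨ht, ?_⟩
      rw [piecewise_eq_of_mem _ _ _ (show t ∈ Ico 0 T from ⟨ha.trans ht.1, ht.2⟩), hf]
      simp only
      linarith
    · rintro ⟨ht, hle⟩
      refine ⟨ht, ?_⟩
      rw [piecewise_eq_of_mem _ _ _ (show t ∈ Ico 0 T from ⟨ha.trans ht.1, ht.2⟩), hf] at hle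
      simp only at hle
      linarith
  rw [hset]
  exact measurableSet_Ico.inter (measurableSet_le hmeas measurable_const)

end Summit.NavierStokesRegularity.NavierStokesRegularity.Theorems.DepletionLadder.PerFlow

end
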